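import Mathlib
import Literature.AlgebraicGeometry.Morphisms.CechModule
import Summits.ResolutionOfSingularities.ResolutionOfSingularities.Theorems.HomologicalConductorNoZenoFullSheafHartogs
import HarnessLib

/-!
# Full sheaves: a section on a punctured neighbourhood of a closed point extends, when `Ȟ¹(M̃) = 0`
# (G2 (iv) input, chain W4.4)

`[OURS · L W4.4]` Crux `HomologicalConductor.NoZenoR` (stmt-ResolutionOfSingularities-19943; twin `NoZeno`
stmt-16483), line `sandwich-cluster`, S3 Layer 2, G-layer item **G2 (iv) «the full sheaf `M̃ = 𝒪_X · N` is
locally free»** (holder's cut 2026-08-27T06:00:41Z: this seat), over res-D-pv-045 AS res-L0-w44-stub-8's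
OBJECT `FullSheaf.generatedSheaf` (p500643) and the tree's Čech groups `CechMH1` (`Morphisms/CechModule`).
Third step of the route «`M̃^{∨∨}/M̃` is supported at closed points; `Ȟ⁰ ↪ Ȟ¹(M̃) = 0`», done WITHOUT the
quotient sheaf: the obstruction is an explicit Čech 1-cocycle.

* `exists_affine_cover_off` — for a closed point `y₀` of a noetherian scheme and an open `U₀ ∋ y₀`: an
  affine open `U_* ∋ y₀` inside `U₀` and finitely many affine opens avoiding `y₀` that cover `X ∖ {y₀}`;
* **`mem_stalkSpan_of_forall_ne_of_cechH1`** — `T` a noetherian normal domain, `π : X ⟶ Spec T` proper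
  birational (`X` integral noetherian), `N` a reflexive `T`-submodule of a `K(X)`-space `V` (action through
  `baseToFunctionField π`), `M̃ = 𝒪_X · N`, `y₀` a CLOSED point over a prime of height `> 1`, and
  `Ȟ¹(𝒰, M̃) = 0` for all finite affine covers (G2 (iii)).  If a vector `h` lies in `𝒪_{X,x} · N` for every
  `x ≠ y₀` of a neighbourhood of `y₀`, then `h ∈ 𝒪_{X,y₀} · N`.  Proof: on the cover
  `{U_*} ∪ {V_j}` the 1-cochain `d⁰(h, 0, …, 0)` is a cocycle OF `M̃` (its values `±h` live on
  `U_* ∩ V_j ⊆ U₀ ∖ {y₀}`); it is a coboundary `d⁰ b`; then `b' := b_*(y₀) - h` lies in `𝒪_{X,x} · N` for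
  all `x ≠ y₀`, hence in `N` by Hartogs for full sheaves (`mem_of_forall_height_le_one_mem_stalkSpan`,
  p505405), and `h = b_*(y₀) - b' ∈ 𝒪_{X,y₀} · N`.

Replaces the role of no printed item of the manuscript under review (Hironaka 2017); AI-written, weaker
than expert review. [cite: ArtinVerdier1985, Lemma (1.1)]; [cite: StacksProject, Tag 01ED]
-/

-- single-problem summit: the doubled namespace component `ResolutionOfSingularities` is forced
set_option linter.dupNamespace false

noncomputable section

open CategoryTheory AlgebraicGeometry TopologicalSpace Opposite
open Literature.AlgebraicGeometry.Resolution Literature.AlgebraicGeometry.Motives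
open Literature.AlgebraicGeometry.Morphisms

namespace Summit.ResolutionOfSingularities.ResolutionOfSingularities.Theorems.NoZeno.SandwichCluster.FullSheaf

variable {X : Scheme.{0}} [IsIntegral X]

/-! ## An affine cover adapted to a closed point -/

omit [IsIntegral X] in
/-- For a closed point `y₀` of a noetherian scheme and an open `U₀ ∋ y₀`: an affine open neighbourhood
`U_* ⊆ U₀` of `y₀` and a finite family of affine opens NOT containing `y₀` which covers `X ∖ {y₀}`.
[folklore] -/
theorem exists_affine_cover_off [IsNoetherian X] (y₀ : X) (hy₀ : IsClosed ({y₀} : Set X))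
    (U₀ : X.Opens) (hy₀U₀ : y₀ ∈ U₀) :
    ∃ (κ : Type) (_ : Finite κ) (Ustar : X.Opens) (Vs : κ → X.Opens), IsAffineOpen Ustar ∧ y₀ ∈ Ustar ∧
      Ustar ≤ U₀ ∧ (∀ j, IsAffineOpen (Vs j)) ∧ (∀ j, y₀ ∉ Vs j) ∧ ∀ x : X, x ≠ y₀ → ∃ j, x ∈ Vs j := by
  classical
  obtain ⟨_, ⟨Ustar, hUstar, rfl⟩, hy₀Ustar, hUstarU₀⟩ :=
    X.isBasis_affineOpens.exists_subset_of_mem_open hy₀U₀ U₀.isOpen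
  -- affine neighbourhoods inside the open complement of `y₀`
  have hopen : IsOpen ({y₀}ᶜ : Set X) := hy₀.isOpen_compl
  have hV : ∀ x : ↥({y₀}ᶜ : Set X), ∃ V : X.Opens, IsAffineOpen V ∧ (x : X) ∈ V ∧ (V : Set X) ⊆ {y₀}ᶜ :=
    fun x => by
      obtain ⟨_, ⟨V, hV, rfl⟩, hxV, hVc⟩ := X.isBasis_affineOpens.exists_subset_of_mem_open x.2 hopen
      exact ⟨V, hV, hxV, hVc⟩
  choose V hVaff hxV hVc using hV
  have hcompact : IsCompact ({y₀}ᶜ : Set X) := NoetherianSpace.isCompact _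
  obtain ⟨t, ht⟩ := hcompact.elim_finite_subcover (fun x => (V x : Set X)) (fun x => (V x).2)
    (fun x hx => Set.mem_iUnion.mpr ⟨⟨x, hx⟩, hxV ⟨x, hx⟩⟩)
  refine ⟨↥t, inferInstance, Ustar, fun j => V j.1, hUstar, hy₀Ustar, hUstarU₀, fun j => hVaff j.1,
    fun j hj => hVc j.1 hj rfl, fun x hx => ?_⟩
  obtain ⟨i, hi, hxi⟩ := Set.mem_iUnion₂.mp (ht hx)
  exact ⟨⟨i, hi⟩, hxi⟩

/-! ## Sections: a few more evaluation rules -/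

section Fn

variable (V : Type) [AddCommGroup V] [Module X.functionField V] (S : Set V)

/-- `fn` of a difference. [folklore] -/
theorem fn_sub {U : X.Opens} (s s' : Γ(generatedSheaf V S, U)) : fn V S (s - s') = fn V S s - fn V S s' := rfl

end Fn

/-! ## The cocycle argument -/

variable {T : Type} [CommRing T] [IsDomain T] [IsNoetherianRing T] [IsIntegrallyClosed T]
variable (π : X ⟶ Spec (.of T))
variable {V : Type} [AddCommGroup V] [Module X.functionField V] [Module T V]

/-- **A section of `M̃ = 𝒪_X · N` on a punctured neighbourhood of a closed point extends over the point,
when `Ȟ¹(M̃) = 0`.**  See the module docstring for the statement and the Čech argument.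
[cite: ArtinVerdier1985, Lemma (1.1)]; [cite: StacksProject, Tag 01ED] -/
theorem mem_stalkSpan_of_forall_ne_of_cechH1 [IsNoetherian X] [IsProper π] (hπ : IsBirational π)
    (hmod : ∀ (a : T) (v : V), a • v = baseToFunctionField π a • v)
    (N : Submodule T V) [Module.IsReflexive T N]
    (hH1 : ∀ (ι : Type) [Finite ι] (U : ι → X.Opens), (∀ i, IsAffineOpen (U i)) → ⨆ i, U i = ⊤ →
      Subsingleton (CechMH1 π (generatedSheaf V (N : Set V)) U))
    (y₀ : X) (hy₀ : IsClosed ({y₀} : Set X)) (hht : ¬ (π.base y₀).asIdeal.height ≤ 1)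
    {h : V} (U₀ : X.Opens) (hy₀U₀ : y₀ ∈ U₀)
    (hU₀ : ∀ x : X, x ∈ U₀ → x ≠ y₀ → h ∈ stalkSpan V (N : Set V) x) :
    h ∈ stalkSpan V (N : Set V) y₀ := by
  classical
  set S : Set V := (N : Set V) with hS
  set M := generatedSheaf (X := X) V S with hM
  obtain ⟨κ, _, Ustar, Vs, hUstar, hy₀Ustar, hUstarU₀, hVsaff, hy₀Vs, hcov⟩ :=
    exists_affine_cover_off y₀ hy₀ U₀ hy₀U₀
  -- the cover `{U_*} ∪ {V_j}`
  let U : Option κ → X.Opens := fun i => i.elim Ustar Vs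
  have hUaff : ∀ i, IsAffineOpen (U i) := fun i => by
    cases i with
    | none => exact hUstar
    | some j => exact hVsaff j
  have hUcov : ⨆ i, U i = ⊤ := by
    rw [eq_top_iff]
    rintro x -
    rw [Opens.mem_iSup]
    by_cases hx : x = y₀
    · exact ⟨none, hx ▸ hy₀Ustar⟩
    · obtain ⟨j, hj⟩ := hcov x hx
      exact ⟨some j, hj⟩
  -- the values of the cochain `(h, 0, …, 0)` and of its coboundary
  let e : Option κ → V := fun i => i.elim h (fun _ => 0)
  have hval : ∀ (i j : Option κ) (x : X), x ∈ U i ⊓ U j → e j - e i ∈ stalkSpan V S x := by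
    intro i j x hx
    -- off the diagonal `{none}`, the point lies in `U_* ∩ V_j ⊆ U₀ ∖ {y₀}`
    have key : ∀ j : κ, x ∈ Ustar → x ∈ Vs j → h ∈ stalkSpan V S x := fun j hxU hxV =>
      hU₀ x (hUstarU₀ hxU) (fun hxy => hy₀Vs j (hxy ▸ hxV))
    cases i with
    | none =>
      cases j with
      | none => simp [e]
      | some j => simpa [e] using (stalkSpan V S x).neg_mem (key j hx.1 hx.2)
    | some i =>
      cases j with
      | none => simpa [e] using key i hx.2 hx.1
      | some j => simp [e]
  let c : CechMC1 π M U := fun i j => mkSection V S (U i ⊓ U j) (e j - e i) (fun x hx => hval i j x hx)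
  have hfn_c : ∀ (i j : Option κ) (x : ↥(U i ⊓ U j)), fn V S (c i j) x = e j - e i := fun i j x => rfl
  -- `c` is a cocycle
  have hc : c ∈ cechMZ1 π M U := by
    rw [mem_cechMZ1_iff]
    funext i j k
    rw [cechMD1_apply]
    apply section_ext V S
    funext x
    change e k - e j - (e k - e i) + (e j - e i) = (0 : V)
    abel
  -- `Ȟ¹ = 0`: `c` is a coboundary `d⁰ b`
  haveI := hH1 (Option κ) U hUaff hUcov
  have hcB : c ∈ cechMB1 π M U := by
    have h0 : CechMH1.mk π M U ⟨c, hc⟩ = 0 := Subsingleton.elim _ _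
    exact (CechMH1.mk_eq_zero_iff π M U ⟨c, hc⟩).mp h0
  obtain ⟨b, hb⟩ := (mem_cechMB1_iff π M U c).mp hcB
  -- the vector `b_*(y₀) ∈ 𝒪_{X,y₀} · N` and `b' := b_*(y₀) - h`
  let bstar : V := fn V S (b none) ⟨y₀, hy₀Ustar⟩
  have hbstar : bstar ∈ stalkSpan V S y₀ := fn_mem_stalkSpan V S (b none) ⟨y₀, hy₀Ustar⟩
  -- `b' ∈ 𝒪_{X,x} · N` for every `x ≠ y₀`
  have hb' : ∀ x : X, x ≠ y₀ → bstar - h ∈ stalkSpan V S x := by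
    intro x hx
    obtain ⟨j, hxj⟩ := hcov x hx
    obtain ⟨z, hz⟩ := exists_mem_inf (U := Ustar) (U' := Vs j) ⟨y₀, hy₀Ustar⟩ ⟨x, hxj⟩
    -- evaluate `(d⁰ b)_{*, j} = c_{*, j}` at `z`
    have h1 := congrFun (congrFun hb none) (some j)
    rw [cechMD0_apply] at h1
    have h2 := congrArg (fun s => fn V S s ⟨z, hz⟩) h1
    -- `fn (b_j) z - fn (b_*) z = 0 - h`
    have h3 : fn V S (b (some j)) ⟨z, hz.2⟩ - fn V S (b none) ⟨z, hz.1⟩ = 0 - h := h2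
    have hbj : fn V S (b (some j)) ⟨x, hxj⟩ = bstar - h := by
      have hz1 : fn V S (b (some j)) ⟨x, hxj⟩ = fn V S (b (some j)) ⟨z, hz.2⟩ :=
        fn_apply_eq_fn_apply V S _ _ _
      have hz2 : fn V S (b none) ⟨z, hz.1⟩ = bstar := fn_apply_eq_fn_apply V S _ _ _
      rw [hz1]
      rw [hz2, zero_sub] at h3
      exact (sub_eq_iff_eq_add.mp h3).trans (by abel)
    rw [← hbj]
    exact fn_mem_stalkSpan V S (b (some j)) ⟨x, hxj⟩
  -- Hartogs: `b' ∈ N`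
  have hb'N : bstar - h ∈ N :=
    mem_of_forall_height_le_one_mem_stalkSpan π hπ hmod N fun x hx => hb' x (fun hxy => hht (hxy ▸ hx))
  -- conclude
  have : h = bstar - (bstar - h) := by abel
  rw [this]
  exact (stalkSpan V S y₀).sub_mem hbstar (subset_stalkSpan V S y₀ hb'N)

end Summit.ResolutionOfSingularities.ResolutionOfSingularities.Theorems.NoZeno.SandwichCluster.FullSheaf

end
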